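/-
Origin: expansion seat `planner-pub-hodgecm-toy2-g6-0`, handover #6 2026-08-18T11:44:11Z (2e3b2cd7 207 l.; RUN 29 additive leaf; after #4 and #5; rewrite import Toy2g6.ToyProdSection -> HodgeCM.Model.Toy.ToyProdSection x1, import Toy2g6.IndependenceLedger -> HodgeCM.Model.Toy.IndependenceLedger x1) (`HOME/pub-hodgecm-toy2-g6/lean/Toy2g6/ToyPadRestrict.lean`, md5 2e3b2cd7, 207 lines);
landed by the gen-8 packager in gate run 29 as `HodgeCM/Model/Toy/ToyPadRestrict.lean` (import ^import Toy2g6\.ToyProdSection[ \t]*$→import HodgeCM.Model.Toy.ToyProdSection ×1; import ^import Toy2g6\.IndependenceLedger[ \t]*$→import HodgeCM.Model.Toy.IndependenceLedger ×1; stripped 1 #print/#check/#eval lines).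
-/
/-
Copyright: pub-hodgecm cell (HodgeCMPerL). Consistency-witness layer (part (6a)(ii)); FACTS.md §1c, column P5 — row (S).
Origin: HOME/pub-hodgecm-toy2-g6/lean/Toy2g6/ToyPadRestrict.lean (WIP module `Toy2g6.ToyPadRestrict`; intended final
place `HodgeCM/Model/Toy/ToyPadRestrict.lean` = module `HodgeCM.Model.Toy.ToyPadRestrict`, CONTRIBUTING §3 kind L5)
(seat planner-pub-hodgecm-toy2-g6-0, CONSISTENCY seat 2, generation 6).
WIP imports to rewrite on landing: `import Toy2g6.ToyProdSection` ↦ `import HodgeCM.Model.Toy.ToyProdSection` and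
`import Toy2g6.IndependenceLedger` ↦ `import HodgeCM.Model.Toy.IndependenceLedger` (both RUN-29 rows of this seat,
handovers #4 and #5; land order #3, #4, #5, then this file).
-/
import Summits.HodgeConjecture.HodgeCM.Model.Toy.ToyProdSection
import Summits.HodgeConjecture.HodgeCM.Model.Toy.IndependenceLedger

/-!
# (S) `Fact_prodSection` is independent of M1–M28 and of the whole one-name ledger

`HOME/FACTS.md` §1c, new row (S) `Universe.Fact_prodSection` ("both projections of every product have a
section", the class-M input from which F2 = M35 `Fact_factorActDescends` is DERIVED in
`Proofs/Pohlmann/FactorActDescent.lean`). This file fills its P5 cell: (S) is **not** a consequence of the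
model axioms M1–M28, not even together with every fact of the one-name ledger `Toy.LedgerFacts`
(N1–N4, F2, F4, F5, F7, F7d, F7d-B, F-H0, N5, M38, D, `Fact_H0_rank`).

## The separating model: the pad-safe restriction of the exterior toy universe

Keep all objects, cohomology, Hodge structures, algebraic classes and traces of the exterior toy universe
`toyModelWith D` and RESTRICT THE MORPHISMS (pv04's `Universe.restrict`, `Model/RestrictMor.lean`) to the
class of **pad-safe** maps: a map `f : X → Y` is pad-safe if `Y` padded (extra dimension `≠ 0`) forces `X`
padded. Identities, composites, both projections `X × Y → X`, `X × Y → Y` and pairings of pad-safe maps are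
pad-safe (the extra dimension of a product is the sum), and every map whose target is a CM product
(extra dimension `0`) is pad-safe — so the four existence axioms M17, M18, M24, M25, the CM-inflation maps of
M38 and every endomorphism of every CM product survive, and all of `ModelAxioms` and of `LedgerFacts`
transfer (pv04's transfer lemmas, `CMInflationIndependent{Ledger,Blocks,All}.lean`).

But the unpadded CM abelian variety `A = A_{(ℚ(ζ₇),Φ₀)}` admits NO pad-safe map to the padded product
`A × S` (`S` = the Picard-modular-surface object, extra dimension `2`): the first projection `A × S → A` has no
section, so (S) FAILS (`not_fact_prodSection_padSafeModel`).

## Results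

* `Toy.padSafeModel_modelAxioms`, `Toy.padSafeModel_ledgerFacts` — M1–M28 and the whole ledger hold in the pad-safe
  restriction;
* `Toy.not_fact_prodSection_padSafeModel` — (S) fails there;
* `Toy.prodSection_independent : (∃ U, U.ModelAxioms ∧ LedgerFacts U ∧ U.Fact_prodSection) ∧
  (∃ U, U.ModelAxioms ∧ LedgerFacts U ∧ ¬ U.Fact_prodSection)` — the P5 cell of row (S).

Remark. F2 holds in the separating model although (S) fails: the hypothesis (S) of
`Universe.fact_factorActDescends_of_prodSection` is sufficient, not necessary (F2 only needs sections of
projections between CM products, which are pad-safe).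

No new axioms (`#print axioms` = `[propext, Classical.choice, Quot.sound]`).
-/

noncomputable section

open scoped BigOperators

namespace HodgeCM

open Literature.AlgebraicGeometry.Motives

namespace Toy

open CMInflationIndependent GaloisClosure exteriorPower

variable (D : HodgeData)

/-! ### Pad-safe maps -/

/-- A map of toy objects `X → Y` is **pad-safe** if a padded target forces a padded source. -/
def PadSafe {X Y : Obj} (_f : Obj.Hom X Y) : Prop := Y.extra ≠ 0 → X.extra ≠ 0

omit D in
/-- A map with unpadded target is pad-safe. -/
lemma padSafe_of_extra_eq_zero {X Y : Obj} (f : Obj.Hom X Y) (hY : Y.extra = 0) : PadSafe f :=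
  fun h => (h hY).elim

omit D in
/-- An endomorphism is pad-safe. -/
lemma padSafe_self {X : Obj} (f : Obj.Hom X X) : PadSafe f := fun h => h

/-- The pad-safe maps as a morphism class of the toy universe. -/
def padSafeClass : (toyModelWith D).MorClass where
  P f := PadSafe f
  id_mem _ := fun h => h
  comp_mem _ _ hf hg := fun h => hf (hg h)
  fst_mem X Y := fun h => by
    change X.extra + Y.extra ≠ 0
    omega
  snd_mem X Y := fun h => by
    change X.extra + Y.extra ≠ 0
    omega

/-- **The pad-safe toy universe** (reducible, so that its fields compute). -/
@[reducible] def padSafeModel : Universe := (toyModelWith D).restrict (padSafeClass D)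

/-! ### The four existence axioms and M38 in the pad-safe universe -/

/-- M18: the pairing of pad-safe maps is pad-safe. -/
theorem padSafe_fact_lift : (padSafeModel D).Fact_lift := fun X Y Z f g =>
  ⟨⟨Obj.lift f.1 g.1, fun h => by
      have h' : X.extra + Y.extra ≠ 0 := h
      by_cases hX : X.extra = 0
      · exact g.2 (by omega)
      · exact f.2 hX⟩,
    Subtype.ext (Obj.lift_comp_fst f.1 g.1), Subtype.ext (Obj.lift_comp_snd f.1 g.1)⟩

/-- M24: endomorphisms of `A_{(K,Φ)}` are pad-safe. -/
theorem padSafe_fact_cmEnd : (padSafeModel D).Fact_cmEnd := fun K Φ a => by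
  obtain ⟨e, he⟩ := HodgeCM.Toy.fact_cmEnd D K Φ a
  exact ⟨⟨e, padSafe_of_extra_eq_zero e rfl⟩, he⟩

/-- M25: maps `A_{(K,Φ)} → A_{(K,Φ')}` are pad-safe. -/
theorem padSafe_fact_conjIsogeny : (padSafeModel D).Fact_conjIsogeny := fun K Φ Φ' h => by
  obtain ⟨u, hu⟩ := HodgeCM.Toy.fact_conjIsogeny D K Φ Φ' h
  exact ⟨⟨u, padSafe_of_extra_eq_zero u rfl⟩, hu⟩

/-- M17: the domination maps `s`, `π` of the toy are pad-safe (source and target unpadded). -/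
theorem padSafe_fact_cmDominated : (padSafeModel D).Fact_cmDominated := by
  rintro X ⟨K, Φ, rfl⟩
  refine ⟨galoisCMOracle.F K, galoisCMOracle.gal K, galoisCMOracle.six K, 0,
    fun _ => inducedType K (galoisCMOracle.F K) (galoisCMOracle.emb K) Φ,
    ⟨sHom K (galoisCMOracle.F K) (galoisCMOracle.emb K) Φ, fun h => (h rfl).elim⟩,
    ⟨piHom K (galoisCMOracle.F K) (galoisCMOracle.emb K) Φ, fun h => (h rfl).elim⟩,
    1, one_ne_zero, fun k => ?_⟩
  change map k ((sHom K (galoisCMOracle.F K) (galoisCMOracle.emb K) Φ).comp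
    (piHom K (galoisCMOracle.F K) (galoisCMOracle.emb K) Φ)).lin = _
  rw [sHom_comp_piHom, Nat.cast_one, one_pow, one_smul]
  exact map_id

/-- M38: the CM-inflation maps of the toy are pad-safe (target a CM abelian variety). -/
theorem padSafe_fact_cmInflation : (padSafeModel D).Fact_cmInflation := fun K M k Φ => by
  obtain ⟨m, p, hbij, hact⟩ := HodgeCM.Toy.fact_cmInflation D K M k Φ
  exact ⟨m, fun j => ⟨p j, padSafe_of_extra_eq_zero (p j) rfl⟩, hbij, hact⟩

/-- **All of `ModelAxioms` (M1–M28) hold in the pad-safe toy universe** (displaying the dependence on a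
Galois-CM-closure oracle and on M28 for the Hodge datum `D`, like `toyModel_axioms_of`). -/
theorem padSafeModel_axioms_of (O : GaloisCMOracle) (h28 : (toyModelWith D).Fact_algDuality) :
    (padSafeModel D).ModelAxioms :=
  (toyModel_axioms_of D O h28).restrict (padSafeClass D) (padSafe_fact_cmDominated D) (padSafe_fact_lift D)
    (padSafe_fact_cmEnd D) (padSafe_fact_conjIsogeny D)

/-- `ModelAxioms` for the pad-safe EXTERIOR toy universe, unconditionally. -/
theorem padSafeModel_modelAxioms : (padSafeModel exteriorHodgeData).ModelAxioms :=
  padSafeModel_axioms_of exteriorHodgeData galoisCMOracle fact_algDuality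

/-! ### The whole one-name ledger holds in the pad-safe exterior universe -/

/-- Every fact of the one-name ledger `LedgerFacts` transfers from the exterior toy universe to its pad-safe
restriction. -/
theorem padSafeModel_ledgerFacts : LedgerFacts (padSafeModel exteriorHodgeData) := by
  obtain ⟨hN1, hN2, hN3, hN4, hF2, hF4, hF5, hF7, hF7d, -, hU, hN5, -, hD, hH0⟩ := toyModel_ledgerFacts
  have hF7d' : (padSafeModel exteriorHodgeData).Fact_gysinDescent :=
    (toyModelWith exteriorHodgeData).restrict_fact_gysinDescent _ hF7d
  exact ⟨(toyModelWith exteriorHodgeData).restrict_fact_cupExterior _ hN1,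
    (toyModelWith exteriorHodgeData).restrict_fact_cup_hodge _ hN2,
    (toyModelWith exteriorHodgeData).restrict_fact_pull_H0 _ hN3,
    (toyModelWith exteriorHodgeData).restrict_fact_hodge_F0 _ hN4,
    (toyModelWith exteriorHodgeData).restrict_fact_factorActDescends _ (fun _ _ _ f => padSafe_self f) hF2,
    (toyModelWith exteriorHodgeData).restrict_fact_cupAlg _ hF4,
    (toyModelWith exteriorHodgeData).restrict_fact_cupAssoc _ hF5,
    (toyModelWith exteriorHodgeData).restrict_fact_gysin _ hF7,
    hF7d',
    Universe.gysinDescentB_of_gysinDescent hF7d',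
    (toyModelWith exteriorHodgeData).restrict_fact_unitH0 _ hU,
    hN5,
    padSafe_fact_cmInflation exteriorHodgeData,
    (toyModelWith exteriorHodgeData).restrict_fact_dimProd _ hD,
    (toyModelWith exteriorHodgeData).restrict_fact_H0_rank _ hH0⟩

/-! ### (S) fails: `A × S → A` has no pad-safe section -/

/-- In the pad-safe universe the first projection `A_{(ℚ(ζ₇),Φ₀)} × S → A_{(ℚ(ζ₇),Φ₀)}` (`S` the padded
surface object) has no section: there is no pad-safe map from the unpadded `A` to the padded `A × S` at all. -/
theorem not_fact_prodSection_padSafeModel : ¬ (padSafeModel D).Fact_prodSection := by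
  intro h
  obtain ⟨⟨s, hs⟩, -⟩ := (h (cmObj cyclo7 (stdCMType cyclo7)) pmsObj).1
  exact hs (by change (0 : ℕ) + 2 ≠ 0; omega) rfl

/-- **(S) `Fact_prodSection` is independent of M1–M28 together with the whole one-name ledger**: it holds in
the exterior toy universe (`Toy.toyModel_fact_prodSection`) and fails in its pad-safe restriction, both of which
satisfy `ModelAxioms ∧ LedgerFacts`. This is the P5 cell of row (S) of `HOME/FACTS.md` §1c. -/
theorem prodSection_independent :
    (∃ U : Universe, U.ModelAxioms ∧ LedgerFacts U ∧ U.Fact_prodSection) ∧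
    (∃ U : Universe, U.ModelAxioms ∧ LedgerFacts U ∧ ¬ U.Fact_prodSection) :=
  ⟨⟨toyModel, toyModel_modelAxioms, toyModel_ledgerFacts, toyModel_fact_prodSection⟩,
    ⟨padSafeModel exteriorHodgeData, padSafeModel_modelAxioms, padSafeModel_ledgerFacts,
      not_fact_prodSection_padSafeModel exteriorHodgeData⟩⟩

/-- In particular (S) is not derivable from the model axioms and the ledger. -/
theorem not_derivable_prodSection :
    ¬ ∀ U : Universe, U.ModelAxioms → LedgerFacts U → U.Fact_prodSection :=
  fun h => by
    obtain ⟨U, hM, hL, hn⟩ := prodSection_independent.2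
    exact hn (h U hM hL)

/-- F2 holds in the separating model although (S) fails there: the hypothesis (S) of the derivation
`Universe.fact_factorActDescends_of_prodSection` is sufficient, not necessary. -/
theorem padSafeModel_factorActDescends_not_prodSection :
    (padSafeModel exteriorHodgeData).Fact_factorActDescends ∧ ¬ (padSafeModel exteriorHodgeData).Fact_prodSection :=
  ⟨padSafeModel_ledgerFacts.2.2.2.2.1, not_fact_prodSection_padSafeModel exteriorHodgeData⟩

end Toy

end HodgeCM

end

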